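import Summits.QuantumFields.YangMills.Theorems.UnitScaleTiltProp7TopMeanCoverNaturality
import HarnessLib

/-!
# Route `UnitScaleTilt`, crux K1 «MinimiserStabilityRegPr» (stmt-QuantumFields-19200), EX row `hGF`, the (L6) LOD line — SMALL MEMBERS VIA THE COVER, ROW (c2), FILE 2∕2:
# **PRINT'S GAUGE PROJECTOR `R_{Q″} = projR Δ_W Q″` FOR THE TOP NESTED COVARIANT MEAN OF RECORD COMMUTES WITH THE PULLBACK ALONG THE `L^{jc}`-FOLD COVER** —
# `R_{Q″_c}(W∘π)(λ̃∘π) = (R_{Q″}(W)λ̃)∘π`, hence `‖R_{Q″_c}(W∘π)(y∘π)‖² = (L^{jc})³·‖R_{Q″}(W) y‖²` and the chair's docking row `‖R_{Q″_c}(W∘π)(y∘π)‖² ≤ (L^{jc})³·‖R_{Q″}(W) y‖²`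

Cell `ym3-torus` (HUMAN RULING D-0037: YM₃ on T³ is ladder rung R3 — NOT d = 4, NOT infinite volume, NOT a mass gap, NOT Clay).  Width seat `ym-routeR-w3` (gen 13);
chair ★`ym-ust-19200-p1` g24 2026-08-30 03:25:11Z row (c2), BOOKED 03:35:31Z «(c2) ← routeR-w3 g13» with the pin «prove the INEQUALITY `‖projR (covLapSite (W∘π)) Q″_cov (y∘π)‖² ≤
(L^{jc})³·‖projR (covLapSite W) Q″ y‖²` — what px17 g9's (c3) transfer door `…Prop7CoverTargetTransfer.curvedTarget_of_cover` displays as `hc2`».  THEOREMS ONLY (0 `def`, 0 `sorry`);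
`--supports stmt-QuantumFields-19200 --as helper`, count-neutral.  HONEST LABEL (★★OWNER RULING №33 (6)): linear algebra over landed letters; nothing of `hT` for small members,
the window, `hGF`, EX or the crux is proved here.

THE PROOF.  ✓`Prop7ProjRPullbackIntertwine.projR_intertwine_of_push` (px12 g7): an orthogonal projection onto `Δ′(ker Q″_c)` intertwines with a pullback `π` onto `Δ(ker Q″)`'s as soon
as `π` has an adjoint partner `ρ` (`⟪πf, g⟫ = ⟪f, ρg⟫`) with `πΔ = Δ′π`, `ρΔ′ = Δρ`, `π(ker Q″) ⊆ ker Q″_c`, `ρ(ker Q″_c) ⊆ ker Q″`.  Here `π` = the `ℓ²` pullback along the cover on gauge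
parameters, `ρ` = the fibre sum (✓`Prop7CoverCombLetters.inner_pull_eq_inner_push`), `Δ = covLapSite W`, `Δ′ = covLapSite (W∘π)` (✓`Prop7CoverHilbertPullback.covLapSite_cover`,
✓`covLapSite_symm`), and the two kernel rows are FILE 1 ✓`Prop7TopMeanCoverNaturality.topMean_cover_eq_zero` ∕ `topMean_push_eq_zero` — the top nested covariant mean of record is
natural under pullback AND fibre sum (its transports are constant on the fibres).  So the IDENTITY holds for the `Q″` of record (the chair's caution about the periodic part of
`Δ_c·ker Q″_c` is met: the deck average of an element of `ker Q″_c` is the lift of an element of `ker Q″`, which is exactly the fibre-sum row), and the degree identity of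
✓`norm_sq_toL2S_cover` turns it into the displayed inequality with EQUALITY.  This is the `Q″`-of-record twin of px12 g7's comb-average edition ✓`Prop7CoverCombLetters.RcombL2_cover`.

WHAT IS PROVED (ns `…Theorems.Prop7ProjRTopMeanCover`; `Q₀` any averaging-of-record map at `W` and `Q₁` any at `W ∘ projBond (F.P K) jc 0`, i.e. the `hseq` clauses (iii) of
✓`exists_intertwiner_of_regPr` at `F` and at `F.cover jc`, VERBATIM as in ✓`Prop7TopMeanGaugeCovariance`).
* ★★★ `projR_topMean_cover` — `projR (covLapSite (F.cover jc) … (W∘π)) Q₁ (toL2S (λ∘π)) = toL2S (((toL2S)⁻¹ (projR (covLapSite F … W) Q₀ (toL2S λ))) ∘ π)`.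
* ★★★ `norm_sq_projR_topMean_cover` — `‖projR (… (W∘π)) Q₁ (toL2S ((toL2S⁻¹ y) ∘ π))‖² = (L^{jc})³·‖projR (… W) Q₀ y‖²` (every `y : SiteL2K`);
  ★★★ `norm_sq_projR_topMean_cover_le` — THE DOCKING ROW `hc2` of px17 g9's (c3) door, token for token (`≤`, from the equality);
  ★★ `norm_sq_projR_topMean_DstarL2_cover` — the same at `y := D*_W X̃`, cover side `D*_{W∘π}(X̃∘π)` (✓`DstarL2_cover'`): the `R_{Q″}`-SLOT OF THE LOD TARGET IS DEGREE-MULTIPLICATIVE,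
  alongside slot 1 ✓`re_inner_DeltaEtaSlot_cover` (px12 g7) and slot 3 ✓`Prop7CoverTwistedChartSym.norm_sq_Qk_cover` (px17 g9, (c1)).
HONEST SCOPE.  Identities; no estimate; the transfer itself ((c3)) and every `hT`∕window∕EX statement are NOT here.

References: T. Bałaban, CMP **99** (1985) 389–434 [Balaban1985BackgroundPropagators] ((3.19)–(3.23) pp.393–394); CMP **96** (1984) 223–250 [Balaban1984PropagatorsII] ((2.15)–(2.19)
pp.225–226); CMP **109** (1987) 249–301 [Balaban1987RG1] ((0.1)–(0.2) pp.251–252).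
-/

set_option autoImplicit false

noncomputable section

open scoped BigOperators Matrix.Norms.L2Operator InnerProductSpace

namespace Summit.QuantumFields.YangMills.Theorems.Prop7ProjRTopMeanCover

open Literature.MathematicalPhysics.QuantumFieldTheory.Balaban1983to89
open Literature.MathematicalPhysics.QuantumFieldTheory.Balaban1983to89.T3ContinuumYM3Torus
open T4Continuum BlockAveraging
open BlockAveraging (Idx)
open B7Prop1Explicit (disp)
open B10Eq27TorusAxialLog (holT transl)
open B7TransferAnalyticMean (meanCLM)
open B11Eq103H1Complex (SiteL2K projR)
open T3SectALandauChart (bgUnits)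
open Summit.QuantumFields.YangMills.Theorems.Prop8Chart (emlIterU)
open Summit.QuantumFields.YangMills.Theorems.Prop7SectET3Transport (periodsT3)
open Summit.QuantumFields.YangMills.Theorems.Prop7SectET3HilbertLetters (W₂ toL2 toL2S DstarL2 covLapSite)
open Summit.QuantumFields.YangMills.Theorems.CoverSites
open Summit.QuantumFields.YangMills.Theorems.Prop7ProjRPullbackIntertwine (projR_intertwine_of_push)
open Summit.QuantumFields.YangMills.Theorems.Prop7CoverCombLetters (inner_pull_eq_inner_push covLapSite_symm)
open Summit.QuantumFields.YangMills.Theorems.Prop7CoverHilbertPullback (covLapSite_cover norm_sq_toL2S_cover DstarL2_cover')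
open Summit.QuantumFields.YangMills.Theorems.Prop7TopMeanCoverNaturality (topMean_cover_eq_zero topMean_push_eq_zero)

variable (F : T3Family) (jc : ℕ) {n K : ℕ} (hnK : n ≤ K) (c₀ : ℝ) [Fact (0 < c₀)] (W : GaugeField (F.P K) 0 (Matrix.specialUnitaryGroup (Fin 2) ℂ))
  (Q₀ : SiteL2K ℂ 3 (periodsT3 F K) c₀ W₂ →ₗ[ℂ] (Site (F.P K) (K - n) → Matrix (Fin 2) (Fin 2) ℂ))
  (hseq₀ : ∀ lam : Site (F.P K) 0 → Matrix (Fin 2) (Fin 2) ℂ, ∃ ns : (j : ℕ) → Site (F.P K) j → Matrix (Fin 2) (Fin 2) ℂ, ns 0 = lam ∧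
    (∀ (j : ℕ) (y : Site (F.P K) (j + 1)), ns (j + 1) y = ns j (emb y) - meanCLM (Idx (F.P K)) (Matrix (Fin 2) (Fin 2) ℂ) fun i : Idx (F.P K) =>
      ns j (emb y) - ((holT (emlIterU j (bgUnits F K W)) (emb y) (stairWord i.2.1 (off i.1)) : (Matrix (Fin 2) (Fin 2) ℂ)ˣ) : Matrix (Fin 2) (Fin 2) ℂ) *
        ns j (transl (emb y) (disp (stairWord i.2.1 (off i.1)))) * (((holT (emlIterU j (bgUnits F K W)) (emb y) (stairWord i.2.1 (off i.1)))⁻¹ : (Matrix (Fin 2) (Fin 2) ℂ)ˣ) : Matrix (Fin 2) (Fin 2) ℂ)) ∧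
    ns (K - n) = Q₀ (toL2S F K c₀ lam))
  (Q₁ : SiteL2K ℂ 3 (periodsT3 (F.cover jc) K) c₀ W₂ →ₗ[ℂ] (Site ((F.cover jc).P K) (K - n) → Matrix (Fin 2) (Fin 2) ℂ))
  (hseq₁ : ∀ lam : Site ((F.cover jc).P K) 0 → Matrix (Fin 2) (Fin 2) ℂ, ∃ ns : (j : ℕ) → Site ((F.cover jc).P K) j → Matrix (Fin 2) (Fin 2) ℂ, ns 0 = lam ∧
    (∀ (j : ℕ) (y : Site ((F.cover jc).P K) (j + 1)), ns (j + 1) y = ns j (emb y) - meanCLM (Idx ((F.cover jc).P K)) (Matrix (Fin 2) (Fin 2) ℂ) fun i : Idx ((F.cover jc).P K) =>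
      ns j (emb y) - ((holT (emlIterU j (bgUnits (F.cover jc) K (W ∘ projBond (F.P K) jc 0))) (emb y) (stairWord i.2.1 (off i.1)) : (Matrix (Fin 2) (Fin 2) ℂ)ˣ) : Matrix (Fin 2) (Fin 2) ℂ) *
        ns j (transl (emb y) (disp (stairWord i.2.1 (off i.1)))) *
          (((holT (emlIterU j (bgUnits (F.cover jc) K (W ∘ projBond (F.P K) jc 0))) (emb y) (stairWord i.2.1 (off i.1)))⁻¹ : (Matrix (Fin 2) (Fin 2) ℂ)ˣ) : Matrix (Fin 2) (Fin 2) ℂ)) ∧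
    ns (K - n) = Q₁ (toL2S (F.cover jc) K c₀ lam))

include hnK hseq₀ hseq₁

/-- ★★★ **`R_{Q″_c}(W∘π)(λ̃∘π) = (R_{Q″}(W)λ̃)∘π` — PRINT'S GAUGE PROJECTOR (3.21) FOR THE TOP NESTED COVARIANT MEAN OF RECORD COMMUTES WITH THE PULLBACK ALONG THE COVER**
(✓`projR_intertwine_of_push` with `π := λ̃ ↦ λ̃∘π`, `ρ := π_*`, `Δ := covLapSite W`, `Δ′ := covLapSite (W∘π)`, `Q′ := Q₀`, `Q″ := Q₁`; the kernel rows are FILE 1).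
[cite: Balaban1985BackgroundPropagators, (3.19)–(3.23) pp.393–394; Balaban1984PropagatorsII, (2.18)–(2.19) p.226] -/
theorem projR_topMean_cover (l : Site (F.P K) 0 → Matrix (Fin 2) (Fin 2) ℂ) :
    projR (covLapSite (F.cover jc) n K c₀ (W ∘ projBond (F.P K) jc 0)) Q₁ (toL2S (F.cover jc) K c₀ (l ∘ proj (F.P K) jc 0))
      = toL2S (F.cover jc) K c₀ (((toL2S F K c₀).symm (projR (covLapSite F n K c₀ W) Q₀ (toL2S F K c₀ l))) ∘ proj (F.P K) jc 0) := by
  classical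
  -- the pullback and the fibre sum as ℂ-linear maps between the two members' `L²` spaces of gauge parameters (as in ✓`RcombL2_cover`)
  let πL : SiteL2K ℂ 3 (periodsT3 F K) c₀ W₂ →ₗ[ℂ] SiteL2K ℂ 3 (periodsT3 (F.cover jc) K) c₀ W₂ :=
    (toL2S (F.cover jc) K c₀).toLinearMap ∘ₗ LinearMap.funLeft ℂ (Matrix (Fin 2) (Fin 2) ℂ) (proj (F.P K) jc 0) ∘ₗ (toL2S F K c₀).symm.toLinearMap
  let pushL : (Site ((F.cover jc).P K) 0 → Matrix (Fin 2) (Fin 2) ℂ) →ₗ[ℂ] (Site (F.P K) 0 → Matrix (Fin 2) (Fin 2) ℂ) :=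
    { toFun := push (F.P K) jc 0
      map_add' := fun g g' => by funext x; simp only [push_apply, Pi.add_apply, Finset.sum_add_distrib]
      map_smul' := fun c g => by funext x; simp only [push_apply, Pi.smul_apply, Finset.smul_sum, RingHom.id_apply] }
  let ρL : SiteL2K ℂ 3 (periodsT3 (F.cover jc) K) c₀ W₂ →ₗ[ℂ] SiteL2K ℂ 3 (periodsT3 F K) c₀ W₂ :=
    (toL2S F K c₀).toLinearMap ∘ₗ pushL ∘ₗ (toL2S (F.cover jc) K c₀).symm.toLinearMap
  have hπ : ∀ l' : Site (F.P K) 0 → Matrix (Fin 2) (Fin 2) ℂ, πL (toL2S F K c₀ l') = toL2S (F.cover jc) K c₀ (l' ∘ proj (F.P K) jc 0) := by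
    intro l'
    simp only [πL, LinearMap.comp_apply, LinearEquiv.coe_toLinearMap, LinearEquiv.symm_apply_apply]
    rfl
  have hρ : ∀ g : Site ((F.cover jc).P K) 0 → Matrix (Fin 2) (Fin 2) ℂ, ρL (toL2S (F.cover jc) K c₀ g) = toL2S F K c₀ (push (F.P K) jc 0 g) := by
    intro g
    simp only [ρL, LinearMap.comp_apply, LinearEquiv.coe_toLinearMap, LinearEquiv.symm_apply_apply]
    rfl
  -- (h₁) adjoint pair
  have h₁ : ∀ (f : SiteL2K ℂ 3 (periodsT3 F K) c₀ W₂) (g : SiteL2K ℂ 3 (periodsT3 (F.cover jc) K) c₀ W₂), ⟪πL f, g⟫_ℂ = ⟪f, ρL g⟫_ℂ := by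
    intro f g
    obtain ⟨l', rfl⟩ := (toL2S F K c₀).surjective f
    obtain ⟨g', rfl⟩ := (toL2S (F.cover jc) K c₀).surjective g
    rw [hπ, hρ]
    exact inner_pull_eq_inner_push F jc K c₀ l' g'
  -- (hΔ) the covariant site Laplacian intertwines with the pullback
  have hΔ : ∀ f, πL (covLapSite F n K c₀ W f) = covLapSite (F.cover jc) n K c₀ (W ∘ projBond (F.P K) jc 0) (πL f) := by
    intro f
    obtain ⟨l', rfl⟩ := (toL2S F K c₀).surjective f
    rw [hπ, covLapSite_cover]
    conv_lhs => rw [← (toL2S F K c₀).apply_symm_apply (covLapSite F n K c₀ W (toL2S F K c₀ l'))]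
    rw [hπ]
  -- (hΔ′) … and with the fibre sum (by adjointness and symmetry)
  have hΔ' : ∀ g, ρL (covLapSite (F.cover jc) n K c₀ (W ∘ projBond (F.P K) jc 0) g) = covLapSite F n K c₀ W (ρL g) := by
    intro g
    refine ext_inner_left ℂ fun f => ?_
    rw [← h₁, ← covLapSite_symm, ← hΔ, h₁, covLapSite_symm]
  -- (hQ) the kernel lifts, (hQ′) the fibre sum of the kernel descends — FILE 1
  have hQ : ∀ f, Q₀ f = 0 → Q₁ (πL f) = 0 := by
    intro f hf
    obtain ⟨l', rfl⟩ := (toL2S F K c₀).surjective f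
    rw [hπ]
    exact topMean_cover_eq_zero F jc hnK W Q₀ hseq₀ Q₁ hseq₁ l' hf
  have hQ' : ∀ g, Q₁ g = 0 → Q₀ (ρL g) = 0 := by
    intro g hg
    obtain ⟨g', rfl⟩ := (toL2S (F.cover jc) K c₀).surjective g
    rw [hρ]
    exact topMean_push_eq_zero F jc hnK W Q₀ hseq₀ Q₁ hseq₁ g' hg
  have key := projR_intertwine_of_push (covLapSite F n K c₀ W) (covLapSite (F.cover jc) n K c₀ (W ∘ projBond (F.P K) jc 0)) Q₀ Q₁ πL ρL h₁ hΔ hΔ' hQ hQ' (toL2S F K c₀ l)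
  rw [← hπ, key, ← hπ ((toL2S F K c₀).symm _), LinearEquiv.apply_symm_apply]

/-- ★★★ **THE `R_{Q″}`-SLOT SCALES BY THE DEGREE**: `‖R_{Q″_c}(W∘π)(toL2S ((toL2S⁻¹ y)∘π))‖² = (L^{jc})³·‖R_{Q″}(W) y‖²` for every `y` in the member's `L²` space of gauge parameters.
[cite: Balaban1985BackgroundPropagators, (3.21) p.394; Balaban1987RG1, (0.2) p.252] -/
theorem norm_sq_projR_topMean_cover (y : SiteL2K ℂ 3 (periodsT3 F K) c₀ W₂) :
    ‖projR (covLapSite (F.cover jc) n K c₀ (W ∘ projBond (F.P K) jc 0)) Q₁ (toL2S (F.cover jc) K c₀ ((toL2S F K c₀).symm y ∘ proj (F.P K) jc 0))‖ ^ 2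
      = ((F.L : ℝ) ^ jc) ^ 3 * ‖projR (covLapSite F n K c₀ W) Q₀ y‖ ^ 2 := by
  rw [projR_topMean_cover F jc hnK c₀ W Q₀ hseq₀ Q₁ hseq₁ ((toL2S F K c₀).symm y), norm_sq_toL2S_cover, LinearEquiv.apply_symm_apply, LinearEquiv.apply_symm_apply]

/-- ★★★ **THE DOCKING ROW `hc2` OF THE (c3) TRANSFER DOOR** (chair's pin, px17 g9's binder token for token): for every `y`,
`‖projR (covLapSite (F.cover jc) n K c₀ (W ∘ π)) Q″_c (toL2S (F.cover jc) K c₀ ((toL2S F K c₀)⁻¹ y ∘ π))‖² ≤ (L^{jc})³·‖projR (covLapSite F n K c₀ W) Q″ y‖²` (with equality, by the previous theorem).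
[cite: Balaban1985BackgroundPropagators, (3.21) p.394; Balaban1987RG1, (0.2) p.252] -/
theorem norm_sq_projR_topMean_cover_le :
    ∀ y : SiteL2K ℂ 3 (periodsT3 F K) c₀ W₂,
      ‖projR (covLapSite (F.cover jc) n K c₀ (W ∘ projBond (F.P K) jc 0)) Q₁ (toL2S (F.cover jc) K c₀ ((toL2S F K c₀).symm y ∘ proj (F.P K) jc 0))‖ ^ 2
        ≤ ((F.L : ℝ) ^ jc) ^ 3 * ‖projR (covLapSite F n K c₀ W) Q₀ y‖ ^ 2 :=
  fun y => (norm_sq_projR_topMean_cover F jc hnK c₀ W Q₀ hseq₀ Q₁ hseq₁ y).le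

/-- ★★ **THE `R_{Q″}`-SLOT OF THE LOD TARGET AT THE LIFTED ONE-FORM**: `‖R_{Q″_c}(W∘π) D*_{W∘π}(X̃∘π)‖² = (L^{jc})³·‖R_{Q″}(W) D*_W X̃‖²` (✓`DstarL2_cover'` + the degree identity).
[cite: Balaban1985BackgroundPropagators, (3.8) p.392, (3.21) p.394; Balaban1987RG1, (0.2) p.252] -/
theorem norm_sq_projR_topMean_DstarL2_cover (X : PBond (F.P K) 0 → Matrix (Fin 2) (Fin 2) ℂ) :
    ‖projR (covLapSite (F.cover jc) n K c₀ (W ∘ projBond (F.P K) jc 0)) Q₁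
        (DstarL2 (F.cover jc) n K c₀ (W ∘ projBond (F.P K) jc 0) (toL2 (F.cover jc) K c₀ (X ∘ projBond (F.P K) jc 0)))‖ ^ 2
      = ((F.L : ℝ) ^ jc) ^ 3 * ‖projR (covLapSite F n K c₀ W) Q₀ (DstarL2 F n K c₀ W (toL2 F K c₀ X))‖ ^ 2 := by
  rw [DstarL2_cover', projR_topMean_cover F jc hnK c₀ W Q₀ hseq₀ Q₁ hseq₁, norm_sq_toL2S_cover, LinearEquiv.apply_symm_apply, LinearEquiv.apply_symm_apply]

end Summit.QuantumFields.YangMills.Theorems.Prop7ProjRTopMeanCover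

end
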